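import Literature.MathematicalPhysics.QuantumFieldTheory.BalabanImbrieJaffe1984to88.BIJ88SlotCumulants308

/-!
# `BalabanImbrieJaffe1984to88.BIJ88EffectiveActionGauss308` — T. Bałaban, J. Imbrie, A. Jaffe, *Effective action and cluster properties of the
abelian Higgs model*, Commun. Math. Phys. **114** (1988) 257–315 [BalabanImbrieJaffe1988], Sect. 5.14 p. 308 [PDF 52]: **(5.14.1)–(5.14.2) AT THE
`t = 0` END IN THE §5.13 GAUSSIAN MODEL** — p. 308: *"Thus the restrictions and the interactions disappear at t = 0, at which point we have a purely
Gaussian expectation. Thus we define perturbative terms for the action, 𝒫̃_{k+1}(Λ₁₂^{(k)}) = Σ_{α=1}^{n̄} −(1/α!)(dᵅ/dtᵅ) log z_t(Λ₁₂^{(k)})|_{t=0},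
(5.14.1) and a remainder ℛ_k(Λ₁₂^{(k)}) = ∫₀¹ dt −((1−t)^{n̄}/(n̄+1)!) ⟨d/dt; …; d/dt⟩_t. (5.14.2)"*; p. 304: *"The expectation ⟨ ⟩_1 is in the
measure (1/N)∫dΦ … exp[½⟨Φ,ΔΦ⟩ + ⟨Φ,ℱ⟩]"* (sic: no minus sign in print — its Δ is the negative of the positive form `Δ` of `fieldLaw`, cf. (5.13.2)).

statement-level skeleton of published theorems with citation tags; proofs where landed; nothing here is a claim about the Yang–Mills mass gap

PDF held: `paper:balaban1988-cmp114-bij-abelian-higgs-effective-action` (journal page = PDF page + 256); pp. 304–305, 308–310 = PDF 48–49, 52–54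
read this session (`p0048.txt` last display; `p0049.txt` L1–3, L34–36; `p0052.txt` L20–27).

WHAT IS REPRODUCED (unit `lit-balaban-p36`, generation 11 of the Phase-2 proof seat p36, file 5; SKELETON rows **C2.Eq5.14.1-5.14.2** ((5.14.1)–(5.14.2),
member), **C2.Eq5.14.3-5.14.4** (the law of (5.14.3), member), **C2.Claim@310** (member) of `HOME/lit-balaban-r16/ROWS-C2-part2.md`, owner r16, heads
untouched; the owner's v2.101 successor item for **C2.Eq5.14.5** (2) *"the t = 0 end of (5.14.2) in the zG model (log z₀ = 0) is p36's recorded open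
item"*; HOME `run/shared/lean/pub/lit-balaban/`).  Theorems only (0 definitions):
* §1 THE LAW OF (5.14.3) IS GAUSSIAN: `weight_mul_source_eq` (completing the square, mean field `m = Δ_W⁻¹ℱ_W`), `integral_weight_mul_source_eq`,
  **`fieldLaw_eq_map_gaussProb`** (`fieldLaw blk Δ ℱ W` = the centred Gaussian `dμ_{Δ_W⁻¹}` of `B2Eq228Conditioning` translated by `Δ_W⁻¹ℱ_W`),
  `isGaussian_gaussProb`, **`isGaussian_fieldLaw`**, **`integral_id_fieldLaw`** (mean `= Δ_W⁻¹ℱ_W`).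
* §2 LINEAR SLOT FIELDS: `isLinearMap_ext`, **`hasGaussianLaw_slotFields`** (the `hJ` of gens 7–10 in the model), **`integral_slotField_fieldLaw`**
  (`E[Φ_b] = Φ_b(ext Δ_W⁻¹ℱ_W)`), `slotField_meanField_eq_zero_of_zero` (`ℱ = 0 ⇒` centred), `measurable_slotField`.
* §3 THE `t = 0` END IN THE MODEL: `remR_congr_Ioc`; **`effectiveAction_fieldLaw_eq_pertP_add_remR_ursell`** — for linear slot fields killing the
  mean field (`hcen`), `χ ≥ 0`, `p > 1/2`, `W`-block positive definite, cubes of the slots in `W`, `c_b ≥ c₀ > 0`, measurable bounded terms,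
  `0 < e_k < e^{−1}`, `|L| = n̄+1`: `−log z₁ = 𝒫̃_{k+1} + (n̄+1)·remR(t ↦ Σ_γ uᵀ_{γ,t}(L))` and `= 𝒫̃_{k+1} + ∫₀¹ −((1−t)^{n̄}/n̄!) Σ_γ uᵀ_{γ,t}(L) dt`
  with `z_t = zG blk Δ ℱ (fD_t γ ∅) W W` (`log z₀ = 0` built in: `z₀ = 1`) and `uᵀ` the Ursell cumulants of the slot moments of `fieldLaw` — gen 11's
  `BIJ88SlotCumulants308.effectiveAction_eq_pertP_add_remR_ursell` with `hJ`, `h0` DISCHARGED in the model;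
  **`effectiveAction_fieldLaw_eq_pertP_add_remR_Tsum_of_ineq5144`** (modulo the typed leaf (5.14.4) on `(0,1]` in gen 5's regime: the same with
  `uᵀ` replaced by p25's display-3 connected series `Tsum` over the virtual supports) and **`abs_effectiveAction_sub_pertP_le_of_ineq5144`**
  (`|−log z₁ − 𝒫̃_{k+1}| ≤ (n̄+1)·N_s^{n̄+1}·θ^{(1−β′)(n̄+1)}·4e²θ^{β′}(D+1)·|W|` — the remainder of (5.14.2) IS `O(|W|)` with the `(n̄+1)`-st power
  of the vertex factor, by `BIJ88SlotConnectedGraph310KP.abs_remR_sum_Tsum_le_of_ineq5144`).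
HONEST SCOPE: (a) the slot fields must be LINEAR (as in print: components of `(I − Q_s*Q)A^{(k)}`, `φ^{(k)″}`) and CENTRED: `hcen : Φ_b(ext Δ_W⁻¹ℱ_W) = 0`
— automatic for `ℱ = 0` (`slotField_meanField_eq_zero_of_zero`); for the boundary-localized linear form `ℱ` of p. 305 the fields have mean
`Φ_b(Δ_W⁻¹ℱ_W)` and the non-centred generalization of gens 7–8 (`BIJ88GaussianMoments308`, hypotheses `h0`/`hvar`) is NOT done here; (b) (5.14.4) is
the typed leaf `BIJ88Sect5StatementsPart2.Ineq5144`, used only in the last two theorems; (c) the `(n̄+1)!` of the print vs `n̄!` is the located slip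
GAPS G-C2-p36-06 (both forms given, as in gens 8–11); (d) `Δ := −Δ_print` convention of p25's `BIJ88PolymerRep5134Gauss`.  0 `sorry`, 0 definitions,
0 new `Prop` facts (D-0026); imports `BIJ88SlotCumulants308` only; modifies nothing.  NOT summit progress; NOT continuum; NOT Clay.  Cell `lit-balaban`
Phase 2, seat p36 gen 11 (owner r16, referee ref-5).
-/

noncomputable section

namespace Literature.MathematicalPhysics.QuantumFieldTheory.BalabanImbrieJaffe1984to88.BIJ88EffectiveActionGauss308

open Finset MeasureTheory ProbabilityTheory Matrix
open Literature.Probability.LatticeModels (ursellOf)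
open Literature.MathematicalPhysics.QuantumFieldTheory.Balaban1983to89.B13GaugeDevices (gaussWeight gaussNorm)
open Literature.MathematicalPhysics.QuantumFieldTheory.Balaban1983to89.B2Eq228Conditioning (weight source weight_pos source_pos
  gaussProb gaussNorm_pos isProbabilityMeasure_gaussProb gaussProb_eq_map_multivariateGaussian tilt_eq integrable_gaussWeight)
open BIJ88PolymerRep5134 (corner)
open BIJ88PolymerRep5134Gauss (ext prec src zG)
open BIJ88Expansion5143 (g3 prime)
open BIJ88Expansion5143Gauss (fD)
open BIJ88Expansion5143Ordered (polysOf cvsupp locv wv)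
open BIJ88ConnectedGraphResummation (Tsum)
open BIJ88SlotMoments308 (zt slotMoment)
open BIJ88SlotMomentsGauss308 (fieldLaw uD measurable_ext continuous_ext ext_zero isProbabilityMeasure_fieldLaw zt_fieldLaw_eq_zG)
open BIJ88SlotCumulants308 (effectiveAction_eq_pertP_add_remR_ursell ursell_slotMoment_fieldLaw_eq_Tsum_of_ineq5144)
open BIJ88SlotConnectedGraph310KP (abs_remR_sum_Tsum_le_of_ineq5144)
open BIJ88Ineq5113Covering (cubeSys)
open BIJ88Sect5Statements (CutoffProfile)
open BIJ88Sect5StatementsPart2 (Ineq5144)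
open BIJ88Sect5StatementsPart4 (remR pertP)

/-! ## §1 The law of (5.14.3) is the Gaussian measure of covariance `Δ_W⁻¹` and mean `Δ_W⁻¹ℱ_W` -/

section Law

variable {α I : Type} [Fintype α] [DecidableEq α] [Fintype I] [DecidableEq I]
  (blk : α → I) (Δ : Matrix α α ℝ) (ℱ : α → ℝ) (W : Finset I)

/-- **Completing the square in the §5.13 density**: `e^{−½⟨φ,Δ_Wφ⟩}e^{⟨ℱ_W,φ⟩} = e^{½⟨ℱ_W,Δ_W⁻¹ℱ_W⟩}·e^{−½⟨φ−m,Δ_W(φ−m)⟩}` with the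
MEAN FIELD `m := Δ_W⁻¹ℱ_W` (p. 304: *"The expectation ⟨ ⟩_1 is in the measure (1/N)∫dΦ … exp[½⟨Φ,ΔΦ⟩ + ⟨Φ,ℱ⟩]"* (sic, sign as printed); p. 305: *"Recall that we
have a linear term in the measure, ⟨Φ,ℱ⟩. With this term, integration by parts replaces Φ by C_s(δ/δΦ) + C_sℱ"*) — `W`-block positive definite;
the tree's `B2Eq228Conditioning.tilt_eq`. [cite: BalabanImbrieJaffe1988, (5.14.3) p.309; p.304 last display] -/
theorem weight_mul_source_eq (hPD : (prec blk Δ W (corner ℝ W)).PosDef) (φ : {x : α // blk x ∈ W} → ℝ) :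
    weight (prec blk Δ W (corner ℝ W)) φ * source (src blk ℱ W) φ =
      Real.exp (1 / 2 * (src blk ℱ W ⬝ᵥ ((prec blk Δ W (corner ℝ W))⁻¹ *ᵥ src blk ℱ W))) *
        gaussWeight (prec blk Δ W (corner ℝ W)) (φ - (prec blk Δ W (corner ℝ W))⁻¹ *ᵥ src blk ℱ W) := by
  set A := prec blk Δ W (corner ℝ W)
  set f := src blk ℱ W
  have hAs : A.IsSymm := by
    have h := hPD.isHermitian.eq
    rwa [conjTranspose_eq_transpose_of_trivial] at h
  have hdet : IsUnit A.det := isUnit_iff_ne_zero.2 hPD.det_pos.ne'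
  have h := tilt_eq A hAs hdet (-f) φ
  rw [neg_dotProduct, neg_neg, Matrix.mulVec_neg, dotProduct_neg, neg_dotProduct, neg_neg, ← sub_eq_add_neg] at h
  rw [weight, source, ← Real.exp_add, ← h]
  congr 1
  simp only [dotProduct]
  ring

/-- The partition function of the fields of `W`: `∫ e^{−½⟨φ,Δ_Wφ⟩}e^{⟨ℱ_W,φ⟩}dφ = e^{½⟨ℱ_W,Δ_W⁻¹ℱ_W⟩}·∫ e^{−½⟨φ,Δ_Wφ⟩}dφ` (translation
invariance of `dφ`). [cite: BalabanImbrieJaffe1988, (5.14.3) p.309; p.304 last display] -/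
theorem integral_weight_mul_source_eq (hPD : (prec blk Δ W (corner ℝ W)).PosDef) :
    ∫ φ, weight (prec blk Δ W (corner ℝ W)) φ * source (src blk ℱ W) φ =
      Real.exp (1 / 2 * (src blk ℱ W ⬝ᵥ ((prec blk Δ W (corner ℝ W))⁻¹ *ᵥ src blk ℱ W))) *
        gaussNorm (prec blk Δ W (corner ℝ W)) := by
  simp_rw [weight_mul_source_eq blk Δ ℱ W hPD]
  rw [integral_const_mul, integral_sub_right_eq_self (μ := volume) (gaussWeight (prec blk Δ W (corner ℝ W)))]
  rfl

/-- **THE LAW OF THE FIELDS OF `W` IS THE GAUSSIAN MEASURE OF COVARIANCE `Δ_W⁻¹` AND MEAN `Δ_W⁻¹ℱ_W`**: `fieldLaw blk Δ ℱ W` is the image of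
the centred Gaussian probability measure `dμ_{Δ_W⁻¹}` (`B2Eq228Conditioning.gaussProb (Δ_W)`) under the translation `ψ ↦ ψ + Δ_W⁻¹ℱ_W` — the
normalized density of p. 304 (*"(1/N)∫dΦ … exp[½⟨Φ,ΔΦ⟩ + ⟨Φ,ℱ⟩]"*, sign as printed) implemented with the
positive form, density `e^{−½⟨φ,Δφ⟩+⟨ℱ,φ⟩}` (`W`-block of `Δ` positive definite).
[cite: BalabanImbrieJaffe1988, (5.14.3) p.309; p.304 last display] -/
theorem fieldLaw_eq_map_gaussProb (hPD : (prec blk Δ W (corner ℝ W)).PosDef) :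
    fieldLaw blk Δ ℱ W =
      (gaussProb (prec blk Δ W (corner ℝ W))).map (fun ψ => ψ + (prec blk Δ W (corner ℝ W))⁻¹ *ᵥ src blk ℱ W) := by
  have hws := weight_mul_source_eq blk Δ ℱ W hPD
  rw [fieldLaw, integral_weight_mul_source_eq blk Δ ℱ W hPD]
  set A := prec blk Δ W (corner ℝ W) with hA
  set f := src blk ℱ W with hf
  set m : {x : α // blk x ∈ W} → ℝ := A⁻¹ *ᵥ f with hm
  set cst : ℝ := Real.exp (1 / 2 * (f ⬝ᵥ (A⁻¹ *ᵥ f))) with hcst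
  have hcst0 : 0 < cst := Real.exp_pos _
  have hN : 0 < gaussNorm A := gaussNorm_pos hPD
  have he : (fun ψ : {x : α // blk x ∈ W} → ℝ => ψ + m) = ⇑(MeasurableEquiv.addRight m) := rfl
  rw [he, gaussProb, Measure.map_smul, GaussianToolkit.map_withDensity_equiv, MeasurableEquiv.symm_addRight,
    MeasurableEquiv.coe_addRight, MeasurableEquiv.coe_addRight, map_add_right_eq_self]
  have hdens : (fun φ : {x : α // blk x ∈ W} → ℝ => ENNReal.ofReal (weight A φ * source f φ)) =
      ENNReal.ofReal cst • ((fun x => ENNReal.ofReal (gaussWeight A x)) ∘ fun x => x + -m) := by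
    funext φ
    rw [hws φ, ENNReal.ofReal_mul hcst0.le, Pi.smul_apply, smul_eq_mul, Function.comp_apply, ← sub_eq_add_neg]
  rw [hdens, withDensity_smul' _ _ ENNReal.ofReal_ne_top, smul_smul]
  congr 1
  rw [← ENNReal.ofReal_inv_of_pos (mul_pos hcst0 hN), ← ENNReal.ofReal_mul (inv_nonneg.2 (mul_pos hcst0 hN).le)]
  congr 1
  field_simp

/-- `dμ_{M⁻¹}` (`gaussProb M`, `M` positive definite) is a Gaussian measure in Mathlib's sense (`IsGaussian`): it is Mathlib's
`multivariateGaussian 0 M⁻¹` read through the coordinate equivalence (`B2Eq228Conditioning.gaussProb_eq_map_multivariateGaussian`).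
[cite: BalabanImbrieJaffe1988, (5.14.3) p.309; p.304 last display] -/
theorem isGaussian_gaussProb {κ : Type} [Fintype κ] [DecidableEq κ] {M : Matrix κ κ ℝ} (hM : M.PosDef) :
    IsGaussian (gaussProb M) := by
  rw [gaussProb_eq_map_multivariateGaussian hM]
  have h : (⇑(MeasurableEquiv.toLp 2 (κ → ℝ)).symm : EuclideanSpace ℝ κ → κ → ℝ) = ⇑(EuclideanSpace.equiv κ ℝ) := rfl
  rw [h]
  infer_instance

/-- **the law of the fields of `W` is a Gaussian measure** (p. 308: *"at which point we have a purely Gaussian expectation"*).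
[cite: BalabanImbrieJaffe1988, (5.14.2) p.308; p.304 last display] -/
theorem isGaussian_fieldLaw (hPD : (prec blk Δ W (corner ℝ W)).PosDef) : IsGaussian (fieldLaw blk Δ ℱ W) := by
  rw [fieldLaw_eq_map_gaussProb blk Δ ℱ W hPD]
  haveI := isGaussian_gaussProb hPD
  infer_instance

/-- **the mean of the law is the mean field `Δ_W⁻¹ℱ_W`**: `∫ φ dfieldLaw = Δ_W⁻¹ℱ_W` (the centred Gaussian has mean `0`, Mathlib
`integral_id_multivariateGaussian`). [cite: BalabanImbrieJaffe1988, (5.14.3) p.309; p.304 last display] -/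
theorem integral_id_fieldLaw (hPD : (prec blk Δ W (corner ℝ W)).PosDef) :
    ∫ ω, ω ∂(fieldLaw blk Δ ℱ W) = (prec blk Δ W (corner ℝ W))⁻¹ *ᵥ src blk ℱ W := by
  set A := prec blk Δ W (corner ℝ W)
  set m : {x : α // blk x ∈ W} → ℝ := A⁻¹ *ᵥ src blk ℱ W
  haveI := isGaussian_gaussProb hPD
  haveI := isProbabilityMeasure_gaussProb hPD
  rw [fieldLaw_eq_map_gaussProb blk Δ ℱ W hPD,
    integral_map (φ := fun ψ : {x : α // blk x ∈ W} → ℝ => ψ + m) (f := fun ω => ω) (measurable_add_const m).aemeasurable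
      aestronglyMeasurable_id]
  rw [integral_add IsGaussian.integrable_fun_id (integrable_const m), integral_const, probReal_univ, one_smul]
  -- the centred Gaussian has mean zero
  have h0 : ∫ x, x ∂(gaussProb A) = 0 := by
    rw [gaussProb_eq_map_multivariateGaussian hPD, integral_map_equiv]
    have h : (⇑(MeasurableEquiv.toLp 2 ({x : α // blk x ∈ W} → ℝ)).symm : EuclideanSpace ℝ {x : α // blk x ∈ W} → {x : α // blk x ∈ W} → ℝ) =
        ⇑(EuclideanSpace.equiv {x : α // blk x ∈ W} ℝ : EuclideanSpace ℝ {x : α // blk x ∈ W} →L[ℝ] {x : α // blk x ∈ W} → ℝ) := rfl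
    rw [h, ContinuousLinearMap.integral_comp_comm _ IsGaussian.integrable_fun_id, integral_id_multivariateGaussian, map_zero]
  rw [h0, zero_add]

/-! ## §2 Linear slot fields: jointly Gaussian, mean = value at the mean field -/

omit [Fintype α] [DecidableEq α] [Fintype I] in
/-- Extension by zero of a field on the sites of `W` is linear. [cite: BalabanImbrieJaffe1988, (5.14.3) p.309] -/
theorem isLinearMap_ext : IsLinearMap ℝ (ext blk W : ({x : α // blk x ∈ W} → ℝ) → α → ℝ) := by
  refine ⟨fun φ ψ => ?_, fun r φ => ?_⟩
  · funext x
    simp only [BIJ88PolymerRep5134Gauss.ext, Pi.add_apply]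
    split_ifs <;> simp
  · funext x
    simp only [BIJ88PolymerRep5134Gauss.ext, Pi.smul_apply, smul_eq_mul]
    split_ifs <;> simp

variable {ι : Type*} {B : Finset ι} {Φ : ι → (α → ℝ) → ℝ}

/-- **LINEAR slot fields are jointly Gaussian under the law** (p. 308: the restrictions `χ(c_b p(e_k), Φ_b)` are on the components
`Φ_b` of `(I − Q_s*Q)A^{(k)}` and of `φ^{(k)″}` — LINEAR functionals of the Gaussian field; *"at which point we have a purely Gaussian
expectation"*): for `Φ_b` linear, `b ∈ Λ`, the family `ω ↦ (Φ_b(ext ω))_{b∈Λ}` `HasGaussianLaw` under `fieldLaw blk Δ ℱ W` — the hypothesis `hJ`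
of gens 7–10 (`BIJ88ZtPositivity308`, `BIJ88SlotMoments308`, `BIJ88SlotCumulants308`) IN THE MODEL. [cite: BalabanImbrieJaffe1988, (5.14.2) p.308] -/
theorem hasGaussianLaw_slotFields (hPD : (prec blk Δ W (corner ℝ W)).PosDef) (hlin : ∀ b ∈ B, IsLinearMap ℝ (Φ b)) :
    HasGaussianLaw (fun ω (b : ↥B) => Φ b (ext blk W ω)) (fieldLaw blk Δ ℱ W) := by
  haveI := isGaussian_fieldLaw blk Δ ℱ W hPD
  let T : ({x : α // blk x ∈ W} → ℝ) →ₗ[ℝ] (↥B → ℝ) :=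
    LinearMap.pi fun b : ↥B => ((hlin b b.2).mk' (Φ b)).comp ((isLinearMap_ext blk W).mk' _)
  have hT : (fun ω (b : ↥B) => Φ b (ext blk W ω)) = ⇑(LinearMap.toContinuousLinearMap T) ∘ id := by
    funext ω b
    simp [T]
  rw [hT]
  exact IsGaussian.hasGaussianLaw_id.map _

/-- **the mean of a linear slot field is its value at the mean field**: `∫ Φ_b(ext ω) dfieldLaw(ω) = Φ_b(ext Δ_W⁻¹ℱ_W)` — so the slot fields
are CENTRED iff `Φ_b` kills the mean field (automatic for `ℱ = 0`; for the boundary-localized `ℱ` of p. 305 this is the condition `hcen`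
displayed below). [cite: BalabanImbrieJaffe1988, (5.14.2) p.308; p.305 (Sect. 5.13)] -/
theorem integral_slotField_fieldLaw (hPD : (prec blk Δ W (corner ℝ W)).PosDef) {b : ι} (hlin : IsLinearMap ℝ (Φ b)) :
    ∫ ω, Φ b (ext blk W ω) ∂(fieldLaw blk Δ ℱ W) = Φ b (ext blk W ((prec blk Δ W (corner ℝ W))⁻¹ *ᵥ src blk ℱ W)) := by
  haveI := isGaussian_fieldLaw blk Δ ℱ W hPD
  let ℓ : StrongDual ℝ ({x : α // blk x ∈ W} → ℝ) :=
    LinearMap.toContinuousLinearMap ((hlin.mk' (Φ b)).comp ((isLinearMap_ext blk W).mk' _))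
  have hℓ : ∀ ω, ℓ ω = Φ b (ext blk W ω) := fun ω => by simp [ℓ]
  have h := IsGaussian.integral_dual (μ := fieldLaw blk Δ ℱ W) ℓ
  simp only [hℓ] at h
  rw [h, integral_id_fieldLaw blk Δ ℱ W hPD]

/-- For `ℱ = 0` the mean field vanishes and every linear slot field is centred (the hypothesis `hcen` below, discharged).
[cite: BalabanImbrieJaffe1988, (5.14.2) p.308] -/
theorem slotField_meanField_eq_zero_of_zero {b : ι} (hlin : IsLinearMap ℝ (Φ b)) :
    Φ b (ext blk W ((prec blk Δ W (corner ℝ W))⁻¹ *ᵥ src blk (0 : α → ℝ) W)) = 0 := by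
  have h0 : src blk (0 : α → ℝ) W = 0 := by funext x; simp [BIJ88PolymerRep5134Gauss.src]
  rw [h0, Matrix.mulVec_zero, ext_zero]
  exact (hlin.mk' (Φ b)).map_zero

omit [DecidableEq α] [Fintype I] in
/-- A linear slot field read on the fields of `W` is measurable (continuous). [cite: BalabanImbrieJaffe1988, (5.14.2) p.308] -/
theorem measurable_slotField {b : ι} (hlin : IsLinearMap ℝ (Φ b)) : Measurable fun ω : {x : α // blk x ∈ W} → ℝ => Φ b (ext blk W ω) :=
  ((LinearMap.continuous_of_finiteDimensional (hlin.mk' (Φ b))).comp (continuous_ext blk W)).measurable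

end Law

/-! ## §3 (5.14.1)–(5.14.2) at the `t = 0` end in the model -/

section Model

variable {α I : Type} [Fintype α] [DecidableEq α] [Fintype I] [DecidableEq I]
  (blk : α → I) (Δ : Matrix α α ℝ) (ℱ : α → ℝ) (W : Finset I) (adj : I → I → Prop) [DecidableRel adj] {nbr : I → Finset I} {D : ℕ}
variable (χ : CutoffProfile) {ι υ : Type*} [DecidableEq ι] [DecidableEq υ]
variable {p ek : ℝ} {B : Finset ι} {Φ : ι → (α → ℝ) → ℝ} {c : ι → ℝ} {Ys : Finset υ} {V : υ → (α → ℝ) → ℝ}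
variable (cube : ↥B ⊕ ↥Ys → I) {θ β' : ℝ} {L : Type} [Fintype L] [DecidableEq L]

/-- The remainder `ℛ_k = ∫₀¹ dt −((1−t)^{n̄}/(n̄+1)!)·trunc(t)` of (5.14.2) depends on the truncated function on `(0, 1]` only.
[cite: BalabanImbrieJaffe1988, (5.14.2) p.308] -/
theorem remR_congr_Ioc {f g : ℝ → ℝ} (h : ∀ t ∈ Set.Ioc (0 : ℝ) 1, f t = g t) (nbar : ℕ) : remR f nbar = remR g nbar := by
  rw [remR, remR]
  refine intervalIntegral.integral_congr_ae (Filter.Eventually.of_forall fun t ht => ?_)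
  rw [Set.uIoc_of_le zero_le_one] at ht
  rw [h t ht]

/-- **(5.14.1)–(5.14.2) AT THE `t = 0` END IN THE §5.13 GAUSSIAN MODEL** (p. 308: *"the restrictions and the interactions disappear at t = 0, at which
point we have a purely Gaussian expectation … 𝒫̃_{k+1}(Λ₁₂^{(k)}) = Σ_{α=1}^{n̄} −(1/α!)(dᵅ/dtᵅ) log z_t|_{t=0} … ℛ_k(Λ₁₂^{(k)}) = ∫₀¹ dt −((1−t)^{n̄}/(n̄+1)!)
⟨d/dt;…;d/dt⟩_t"*): in the law `fieldLaw blk Δ ℱ W` of (5.14.3) (`W`-block of `Δ` positive definite), for LINEAR slot fields `Φ_b` killing the mean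
field (`hcen`, automatic for `ℱ = 0`), cubes of the slots in `W`, `χ ≥ 0`, `p > 1/2`, `c_b ≥ c₀ > 0`, measurable bounded terms `|V_Y| ≤ K_Y`,
`0 < e_k < e^{−1}`, `|L| = n̄+1` labels: with `z_t := zG blk Δ ℱ (fD_t γ₀ ∅) W W` (so `z₀ = 1`) and `uᵀ_{γ,t}` the Ursell cumulants of the slot moments,
`−log z₁ = 𝒫̃_{k+1} + (n̄+1)·remR(t ↦ Σ_{γ : L → slots} uᵀ_{γ,t}(L))` and `−log z₁ = 𝒫̃_{k+1} + ∫₀¹ −((1−t)^{n̄}/n̄!) Σ_γ uᵀ_{γ,t}(L) dt` — gen 11's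
`BIJ88SlotCumulants308.effectiveAction_eq_pertP_add_remR_ursell` with its Gaussian hypotheses `hJ`, `h0` DISCHARGED by §§1–2.
[cite: BalabanImbrieJaffe1988, (5.14.1)–(5.14.2) p.308] -/
theorem effectiveAction_fieldLaw_eq_pertP_add_remR_ursell (hχ : ∀ x, 0 ≤ χ.χ₁ x) (hp : 1 / 2 < p)
    (hPD : (prec blk Δ W (corner ℝ W)).PosDef) (hcube : ∀ τ, cube τ ∈ W) (hlin : ∀ b ∈ B, IsLinearMap ℝ (Φ b))
    (hcen : ∀ b ∈ B, Φ b (ext blk W ((prec blk Δ W (corner ℝ W))⁻¹ *ᵥ src blk ℱ W)) = 0)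
    {c₀ : ℝ} (hc₀ : 0 < c₀) (hcb : ∀ b ∈ B, c₀ ≤ c b) (hV : ∀ Y ∈ Ys, Measurable (V Y)) {KY : υ → ℝ}
    (hK : ∀ Y ∈ Ys, ∀ φ, |V Y φ| ≤ KY Y) (hek : 0 < ek) (hek1 : ek < Real.exp (-1)) {nbar : ℕ} (hL : Fintype.card L = nbar + 1)
    (s₀ : ↥B ⊕ ↥Ys) (γ₀ : L → ↥B ⊕ ↥Ys) :
    -Real.log (zG blk Δ ℱ (fD (uD χ p ek B Φ c Ys V 1) cube γ₀ ∅) W W) =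
        pertP (fun t => Real.log (zG blk Δ ℱ (fD (uD χ p ek B Φ c Ys V t) cube γ₀ ∅) W W)) nbar
          + (nbar + 1 : ℝ) * remR (fun t => ∑ γ : L → ↥B ⊕ ↥Ys, ursellOf (fun K' => slotMoment χ p ek B (fun b ω => Φ b (ext blk W ω)) c Ys
              (fun Y ω => V Y (ext blk W ω)) (fieldLaw blk Δ ℱ W) t K' γ) univ) nbar ∧
      -Real.log (zG blk Δ ℱ (fD (uD χ p ek B Φ c Ys V 1) cube γ₀ ∅) W W) =
        pertP (fun t => Real.log (zG blk Δ ℱ (fD (uD χ p ek B Φ c Ys V t) cube γ₀ ∅) W W)) nbar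
          + ∫ t in (0 : ℝ)..1, -((1 - t) ^ nbar / nbar.factorial) *
              ∑ γ : L → ↥B ⊕ ↥Ys, ursellOf (fun K' => slotMoment χ p ek B (fun b ω => Φ b (ext blk W ω)) c Ys
                (fun Y ω => V Y (ext blk W ω)) (fieldLaw blk Δ ℱ W) t K' γ) univ := by
  haveI := isProbabilityMeasure_fieldLaw blk Δ ℱ W hPD
  have hz : ∀ t, zt χ p ek B (fun b ω => Φ b (ext blk W ω)) c Ys (fun Y ω => V Y (ext blk W ω)) (fieldLaw blk Δ ℱ W) t =
      zG blk Δ ℱ (fD (uD χ p ek B Φ c Ys V t) cube γ₀ ∅) W W := fun t =>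
    zt_fieldLaw_eq_zG blk Δ ℱ W χ p ek B Φ c Ys V cube hcube γ₀ t
  have h := effectiveAction_eq_pertP_add_remR_ursell χ hχ hp (fieldLaw blk Δ ℱ W) (Φ := fun b ω => Φ b (ext blk W ω))
    (c := c) (Ys := Ys) (V := fun Y ω => V Y (ext blk W ω)) (hasGaussianLaw_slotFields blk Δ ℱ W hPD hlin)
    (fun b hb => measurable_slotField blk W (hlin b hb))
    (fun b hb => (integral_slotField_fieldLaw blk Δ ℱ W hPD (hlin b hb)).trans (hcen b hb)) hc₀ hcb
    (fun Y hY => (hV Y hY).comp (measurable_ext blk W)) (KY := KY) (fun Y hY ω => hK Y hY _) hek hek1 hL s₀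
  simp only [hz] at h
  exact h

/-- **(5.14.1)–(5.14.2) IN THE MODEL WITH THE REMAINDER AS THE CONNECTED-GRAPH SERIES, MODULO (5.14.4)** (p. 310: *"Thus we have a formula
⟨Π_{j∈H}[;(d/dt)_{γ_j}]⟩_t = Σ … Σ_{G_c} …"*; *"It is now a standard exercise to estimate the expansion, using (5.14.4)"*): under the hypotheses of
`effectiveAction_fieldLaw_eq_pertP_add_remR_ursell`, with `Δ` coupling abutting cubes only, cube-local fields and terms, and the prime-dropped
activities of every assignment at every `t ∈ (0,1]` satisfying the typed leaf (5.14.4) in gen 5's regime (symmetric `adj` of degree `≤ D`,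
`0 < θ ≤ 1`, `0 ≤ β′`, `16(D+1)²θ^{β′/2}e² ≤ 1`): `−log z₁ = 𝒫̃_{k+1} + (n̄+1)·remR(t ↦ Σ_γ T_{γ,t}(L))` and
`−log z₁ = 𝒫̃_{k+1} + ∫₀¹ −((1−t)^{n̄}/n̄!) Σ_γ T_{γ,t}(L) dt`, `T` = p25's `Tsum` of display 3 over the virtual supports (`BIJ88SlotCumulants308`).
[cite: BalabanImbrieJaffe1988, (5.14.1)–(5.14.2) p.308; p.310 display 3; (5.14.4) p.309] -/
theorem effectiveAction_fieldLaw_eq_pertP_add_remR_Tsum_of_ineq5144 (hR : ∀ x y, adj x y → adj y x) (hD : ∀ x, (nbr x).card ≤ D)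
    (hnbr : ∀ x y, adj x y → y ∈ nbr x) (hθ0 : 0 < θ) (hθ1 : θ ≤ 1) (hβ : 0 ≤ β')
    (hsmall : 16 * ((D : ℝ) + 1) ^ 2 * (θ ^ (β' / 2) * Real.exp 2) ≤ 1) (hχ : ∀ x, 0 ≤ χ.χ₁ x) (hp : 1 / 2 < p)
    (hΔ : ∀ x y, blk x ≠ blk y → ¬ adj (blk x) (blk y) → Δ x y = 0) (hPD : (prec blk Δ W (corner ℝ W)).PosDef)
    (hcube : ∀ τ, cube τ ∈ W)
    (hΦloc : ∀ b : B, ∀ φ ψ : α → ℝ, (∀ x, blk x = cube (Sum.inl b) → φ x = ψ x) → Φ b φ = Φ b ψ)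
    (hVloc : ∀ Y : Ys, ∀ φ ψ : α → ℝ, (∀ x, blk x = cube (Sum.inr Y) → φ x = ψ x) → V Y φ = V Y ψ)
    (hlin : ∀ b ∈ B, IsLinearMap ℝ (Φ b)) (hcen : ∀ b ∈ B, Φ b (ext blk W ((prec blk Δ W (corner ℝ W))⁻¹ *ᵥ src blk ℱ W)) = 0)
    {c₀ : ℝ} (hc₀ : 0 < c₀) (hcb : ∀ b ∈ B, c₀ ≤ c b) (hV : ∀ Y ∈ Ys, Measurable (V Y)) {KY : υ → ℝ}
    (hK : ∀ Y ∈ Ys, ∀ φ, |V Y φ| ≤ KY Y) (hek : 0 < ek) (hek1 : ek < Real.exp (-1)) {nbar : ℕ} (hL : Fintype.card L = nbar + 1)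
    (s₀ : ↥B ⊕ ↥Ys) (γ₀ : L → ↥B ⊕ ↥Ys)
    (h5144 : ∀ t ∈ Set.Ioc (0 : ℝ) 1, ∀ γ : L → ↥B ⊕ ↥Ys, Ineq5144 (cubeSys I) (Finset L)
      (prime (g3 adj fun H' => zG blk Δ ℱ (fD (uD χ p ek B Φ c Ys V t) cube γ H')))
      Finset.card (fun H (X : Finset I) => (X \ H.image (cube ∘ γ)).card) θ β') :
    -Real.log (zG blk Δ ℱ (fD (uD χ p ek B Φ c Ys V 1) cube γ₀ ∅) W W) =
        pertP (fun t => Real.log (zG blk Δ ℱ (fD (uD χ p ek B Φ c Ys V t) cube γ₀ ∅) W W)) nbar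
          + (nbar + 1 : ℝ) * remR (fun t => ∑ γ : L → ↥B ⊕ ↥Ys, Tsum ((polysOf W).image (cvsupp adj W)) (locv (cube ∘ γ))
              (wv (prime (g3 adj fun H' => zG blk Δ ℱ (fD (uD χ p ek B Φ c Ys V t) cube γ H')))) univ) nbar ∧
      -Real.log (zG blk Δ ℱ (fD (uD χ p ek B Φ c Ys V 1) cube γ₀ ∅) W W) =
        pertP (fun t => Real.log (zG blk Δ ℱ (fD (uD χ p ek B Φ c Ys V t) cube γ₀ ∅) W W)) nbar
          + ∫ t in (0 : ℝ)..1, -((1 - t) ^ nbar / nbar.factorial) *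
              ∑ γ : L → ↥B ⊕ ↥Ys, Tsum ((polysOf W).image (cvsupp adj W)) (locv (cube ∘ γ))
                (wv (prime (g3 adj fun H' => zG blk Δ ℱ (fD (uD χ p ek B Φ c Ys V t) cube γ H')))) univ := by
  haveI : Nonempty L := Fintype.card_pos_iff.1 (by omega)
  obtain ⟨hA, hB⟩ := effectiveAction_fieldLaw_eq_pertP_add_remR_ursell blk Δ ℱ W χ cube hχ hp hPD hcube hlin hcen hc₀ hcb hV hK
    hek hek1 hL s₀ γ₀
  -- on `(0,1]` the cumulants ARE the connected-graph series (modulo the leaf)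
  have hTs : ∀ t ∈ Set.Ioc (0 : ℝ) 1,
      ∑ γ : L → ↥B ⊕ ↥Ys, ursellOf (fun K' => slotMoment χ p ek B (fun b ω => Φ b (ext blk W ω)) c Ys
          (fun Y ω => V Y (ext blk W ω)) (fieldLaw blk Δ ℱ W) t K' γ) univ =
        ∑ γ : L → ↥B ⊕ ↥Ys, Tsum ((polysOf W).image (cvsupp adj W)) (locv (cube ∘ γ))
          (wv (prime (g3 adj fun H' => zG blk Δ ℱ (fD (uD χ p ek B Φ c Ys V t) cube γ H')))) univ := fun t ht =>
    Finset.sum_congr rfl fun γ _ =>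
      ursell_slotMoment_fieldLaw_eq_Tsum_of_ineq5144 blk Δ ℱ W adj χ cube hR hD hnbr hθ0 hθ1 hβ hsmall hΔ hcube hΦloc hVloc γ
        (h5144 t ht γ) Finset.univ_nonempty
  have hrem := remR_congr_Ioc hTs nbar
  have hint : (∫ t in (0 : ℝ)..1, -((1 - t) ^ nbar / nbar.factorial) *
        ∑ γ : L → ↥B ⊕ ↥Ys, ursellOf (fun K' => slotMoment χ p ek B (fun b ω => Φ b (ext blk W ω)) c Ys
          (fun Y ω => V Y (ext blk W ω)) (fieldLaw blk Δ ℱ W) t K' γ) univ) =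
      ∫ t in (0 : ℝ)..1, -((1 - t) ^ nbar / nbar.factorial) *
        ∑ γ : L → ↥B ⊕ ↥Ys, Tsum ((polysOf W).image (cvsupp adj W)) (locv (cube ∘ γ))
          (wv (prime (g3 adj fun H' => zG blk Δ ℱ (fD (uD χ p ek B Φ c Ys V t) cube γ H')))) univ := by
    refine intervalIntegral.integral_congr_ae (Filter.Eventually.of_forall fun t ht => ?_)
    rw [Set.uIoc_of_le zero_le_one] at ht
    rw [hTs t ht]
  exact ⟨hrem ▸ hA, hint ▸ hB⟩

/-- **THE REMAINDER OF (5.14.2) IS `O(|W|)` WITH THE `(n̄+1)`-ST POWER OF THE VERTEX FACTOR, IN THE MODEL, MODULO (5.14.4)** (p. 310: *"The result is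
|W₆^{(k)′}(X)| ≤ (e^β(L^kε/ε₀)^{1/4−α})^{n̄+1+β′|X|}"*, here globally: `ℛ_k = −log z₁ − 𝒫̃_{k+1}` summed over `W`): under the hypotheses of
`effectiveAction_fieldLaw_eq_pertP_add_remR_Tsum_of_ineq5144`,
`|−log z₁ − 𝒫̃_{k+1}| ≤ (n̄+1)·N_s^{n̄+1}·θ^{(1−β′)(n̄+1)}·2·(2e²θ^{β′}(D+1))·|W|` (`N_s` = the number of slots), by gen 11's
`BIJ88SlotConnectedGraph310KP.abs_remR_sum_Tsum_le_of_ineq5144`. [cite: BalabanImbrieJaffe1988, (5.14.2) p.308; p.310 (Sect. 5.14); (5.14.4) p.309] -/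
theorem abs_effectiveAction_sub_pertP_le_of_ineq5144 (hR : ∀ x y, adj x y → adj y x) (hD : ∀ x, (nbr x).card ≤ D)
    (hnbr : ∀ x y, adj x y → y ∈ nbr x) (hθ0 : 0 < θ) (hθ1 : θ ≤ 1) (hβ : 0 ≤ β')
    (hsmall : 16 * ((D : ℝ) + 1) ^ 2 * (θ ^ (β' / 2) * Real.exp 2) ≤ 1) (hχ : ∀ x, 0 ≤ χ.χ₁ x) (hp : 1 / 2 < p)
    (hΔ : ∀ x y, blk x ≠ blk y → ¬ adj (blk x) (blk y) → Δ x y = 0) (hPD : (prec blk Δ W (corner ℝ W)).PosDef)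
    (hcube : ∀ τ, cube τ ∈ W)
    (hΦloc : ∀ b : B, ∀ φ ψ : α → ℝ, (∀ x, blk x = cube (Sum.inl b) → φ x = ψ x) → Φ b φ = Φ b ψ)
    (hVloc : ∀ Y : Ys, ∀ φ ψ : α → ℝ, (∀ x, blk x = cube (Sum.inr Y) → φ x = ψ x) → V Y φ = V Y ψ)
    (hlin : ∀ b ∈ B, IsLinearMap ℝ (Φ b)) (hcen : ∀ b ∈ B, Φ b (ext blk W ((prec blk Δ W (corner ℝ W))⁻¹ *ᵥ src blk ℱ W)) = 0)
    {c₀ : ℝ} (hc₀ : 0 < c₀) (hcb : ∀ b ∈ B, c₀ ≤ c b) (hV : ∀ Y ∈ Ys, Measurable (V Y)) {KY : υ → ℝ}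
    (hK : ∀ Y ∈ Ys, ∀ φ, |V Y φ| ≤ KY Y) (hek : 0 < ek) (hek1 : ek < Real.exp (-1)) {nbar : ℕ} (hL : Fintype.card L = nbar + 1)
    (s₀ : ↥B ⊕ ↥Ys) (γ₀ : L → ↥B ⊕ ↥Ys)
    (h5144 : ∀ t ∈ Set.Ioc (0 : ℝ) 1, ∀ γ : L → ↥B ⊕ ↥Ys, Ineq5144 (cubeSys I) (Finset L)
      (prime (g3 adj fun H' => zG blk Δ ℱ (fD (uD χ p ek B Φ c Ys V t) cube γ H')))
      Finset.card (fun H (X : Finset I) => (X \ H.image (cube ∘ γ)).card) θ β') :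
    |-Real.log (zG blk Δ ℱ (fD (uD χ p ek B Φ c Ys V 1) cube γ₀ ∅) W W) -
        pertP (fun t => Real.log (zG blk Δ ℱ (fD (uD χ p ek B Φ c Ys V t) cube γ₀ ∅) W W)) nbar| ≤
      (nbar + 1 : ℝ) * ((Fintype.card (L → ↥B ⊕ ↥Ys) : ℝ) *
        ((θ ^ (1 - β')) ^ (nbar + 1) * (2 * (2 * Real.exp 2 * θ ^ β' * ((D : ℝ) + 1)) * W.card))) := by
  obtain ⟨hA, -⟩ := effectiveAction_fieldLaw_eq_pertP_add_remR_Tsum_of_ineq5144 blk Δ ℱ W adj χ cube hR hD hnbr hθ0 hθ1 hβ hsmall hχ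
    hp hΔ hPD hcube hΦloc hVloc hlin hcen hc₀ hcb hV hK hek hek1 hL s₀ γ₀ h5144
  have hb := abs_remR_sum_Tsum_le_of_ineq5144 blk Δ ℱ W adj χ cube hR hD hnbr hθ0 hθ1 hβ hsmall hL h5144
  rw [hA, add_sub_cancel_left, abs_mul, abs_of_nonneg (by positivity : (0 : ℝ) ≤ nbar + 1)]
  exact mul_le_mul_of_nonneg_left hb (by positivity)

end Model

end Literature.MathematicalPhysics.QuantumFieldTheory.BalabanImbrieJaffe1984to88.BIJ88EffectiveActionGauss308

end
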